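import Summits.CriticalPhenomena.Ising3DConformalLimit.Theorems.InverseSquareTelemetryInverseSquareLawUnitarityFromInfraredBound
import HarnessLib

/-!
# Crux `InverseSquareLaw` (stmt-CriticalPhenomena-4495), line `registered` — the rate-free window
# `0 ≤ κ ≤ 2` for the telemetric constant

Route `InverseSquareTelemetry`, sub-problem `Ising3DConformalLimit`; THEOREM-ONLY helper file,
`--supports stmt-CriticalPhenomena-4495` (consequences of the open stub S1 `stub_telemetricLimit`,
sharpening the census of S1/S3 of the registered skeleton `Lines/birth.lean`).

Write `G = criticalTwoPoint 3`, `s(x) = ∑ᵢ xᵢ² = |x|₂²`, `Δ` for the six-neighbour Laplacian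
`latticeLaplacianZd` of `ℤ³` and `T(x) = s(x) · (ΔG)(x)/G(x)` for the telemetry (the crux's
left-hand side, kept verbatim). **Theorem (`telemetricLimit_mem_Icc`).** If `T → κ` along the
cofinite filter of `ℤ³` (the RATE-FREE inverse-square law, stub S1), then `0 ≤ κ ≤ 2`.

* `0 ≤ κ` (`telemetricLimit_nonneg`): the rate-free form of the landed stub S2 — were `κ < 0`, far
  out `ΔG ≤ -(k/s) G` with `k = min(-κ/2, 1/8)`, which `InverseSquareLawUnitarity.no_negative_coupling`
  (weight `s^{-1/4}`, subsolution `s^{-q}`, `h`-transform comparison) shows incompatible with the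
  infrared bound `G ≤ C‖x‖⁻¹`.
* `κ ≤ 2` (`telemetricLimit_le_two`, via `no_strong_repulsion`): were `κ > 2`, far out
  `ΔG ≥ (k/s) G` with `2 < k < κ`, so `G` is a subsolution of `Δ - V`, `V = k/s ≥ 0`; the pure power
  `s^{-p}` with `2p(2p-1) = (k+2)/2 ∈ (2, k)` has `p > 1` and is a supersolution far out (lattice Taylor
  expansion `latticeLaplacianZd_rpow_neg`), so the maximum principle for `Δ - V` with `V ≥ 0`
  (`sub_le_super_of_hTransform` with `h = 1`; decay from `G → 0`) gives `G ≤ M s^{-p}` far out —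
  incompatible with the Simon–Lieb lower bound `G ≥ c‖x‖⁻²` (`criticalTwoPoint_bounds_holds`).

So the telemetric constant of S1, if it exists, lies in the window forced by `1 ≤ α₊(κ) ≤ 2`
(`α₊ = (1+√(1+4κ))/2` the decay exponent, `c‖x‖⁻² ≤ G ≤ C‖x‖⁻¹`), WITHOUT any rate: the Dini
stub S3 is needed only for the sharp two-sided bounds `G ≍ |x|^{-α₊}` of
`EtaBoundsFromTelemetry`, and its live content is `κ ∈ [0, 2]`. Method: Murata (1986),
Pinchover (1994); on graphs Keller–Pinchover–Pogorzelski, J. Spectral Theory 10 (2020) §4.2; all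
statements are elementary consequences of tree theorems and tagged folklore.
-/

noncomputable section

namespace Summit.CriticalPhenomena.Ising3DConformalLimit.Theorems

open Literature.Probability.LatticeModels Finset Set Filter Topology
open Summit.CriticalPhenomena.Ising3DConformalLimit.Theorems.EtaBoundsFromTelemetry

namespace TelemetricWindow

/-! ### Bookkeeping: thresholds and the critical two-point function in the variable `s` -/

/-- A cofinitely-eventual property of sites of `ℤ³` holds on an exterior region `{S ≤ s}`
(`s = ∑ᵢ xᵢ²` is bounded on the finite exceptional set). [folklore] -/
theorem exists_sumSq_threshold {P : Site 3 → Prop} (h : ∀ᶠ x : Site 3 in cofinite, P x) :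
    ∃ S : ℝ, ∀ x : Site 3, S ≤ ∑ i, ((x i : ℤ) : ℝ) ^ 2 → P x := by
  have hF := Filter.eventually_cofinite.1 h
  obtain ⟨B, hB⟩ := (hF.image fun x : Site 3 => ∑ i, ((x i : ℤ) : ℝ) ^ 2).bddAbove
  refine ⟨B + 1, fun x hx => ?_⟩
  by_contra hxP
  have hle : (∑ i, ((x i : ℤ) : ℝ) ^ 2) ≤ B := hB (Set.mem_image_of_mem _ hxP)
  linarith

/-- Far sites on the diagonal: for every `S` there is `x ∈ ℤ³`, `x ≠ 0`, with `S ≤ s(x)`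
(`x = (N, N, N)`, `s = 3N²`). [folklore] -/
theorem exists_site_sumSq_ge (S : ℝ) : ∃ x : Site 3, x ≠ 0 ∧ S ≤ ∑ i, ((x i : ℤ) : ℝ) ^ 2 := by
  obtain ⟨N, hN⟩ := exists_nat_ge (max S 1)
  have hN1 : (1 : ℝ) ≤ N := (le_max_right _ _).trans hN
  have hN2 : S ≤ N := (le_max_left _ _).trans hN
  refine ⟨fun _ => (N : ℤ), fun h => ?_, ?_⟩
  · have h0 : ((N : ℤ) : ℝ) = 0 := by
      have := congr_fun h 0
      simp only [Pi.zero_apply] at this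
      exact_mod_cast this
    push_cast at h0
    linarith
  · rw [Fin.sum_univ_three]
    push_cast
    nlinarith

/-- `G = criticalTwoPoint 3 > 0` off the origin (lower infrared bound of
`criticalTwoPoint_bounds_holds`). [folklore] -/
theorem criticalTwoPoint_pos' (x : Site 3) (hx : x ≠ 0) : 0 < criticalTwoPoint 3 x := by
  obtain ⟨c₀, C₀, hc₀, hb⟩ := criticalTwoPoint_bounds_holds (d := 3) le_rfl
  have h := (hb x hx).1
  have : 0 < c₀ * ‖x‖ ^ (-(((3 : ℕ) : ℝ) - 1)) :=
    mul_pos hc₀ (Real.rpow_pos_of_pos (PerfectScreening.norm_pos_of_ne_zero hx) _)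
  linarith

/-- The infrared upper bound in the variable `s`: `G ≤ C₁ s^{-1/2}` off the origin for some `C₁`
(`G ≤ C₀‖x‖⁻¹` and `‖x‖⁻¹ ≤ √3 s^{-1/2}`). [folklore] -/
theorem criticalTwoPoint_le_rpow_neg_half : ∃ C₁ : ℝ, ∀ x : Site 3, x ≠ 0 →
    criticalTwoPoint 3 x ≤ C₁ * (∑ i, ((x i : ℤ) : ℝ) ^ 2) ^ (-(1 / 2 : ℝ)) := by
  obtain ⟨c₀, C₀, hc₀, hb⟩ := criticalTwoPoint_bounds_holds (d := 3) le_rfl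
  refine ⟨|C₀| * Real.sqrt 3, fun x hx => ?_⟩
  have h := (hb x hx).2
  have hn : 0 < ‖x‖ := PerfectScreening.norm_pos_of_ne_zero hx
  rw [show -(((3 : ℕ) : ℝ) - 2) = (-1 : ℝ) by norm_num, Real.rpow_neg_one] at h
  calc criticalTwoPoint 3 x ≤ C₀ * ‖x‖⁻¹ := h
    _ ≤ |C₀| * ‖x‖⁻¹ := mul_le_mul_of_nonneg_right (le_abs_self _) (inv_nonneg.2 hn.le)
    _ ≤ |C₀| * (Real.sqrt 3 * (∑ i, ((x i : ℤ) : ℝ) ^ 2) ^ (-(1 / 2 : ℝ))) :=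
        mul_le_mul_of_nonneg_left (inv_norm_le_sqrt_three_mul_rpow hx) (abs_nonneg _)
    _ = (|C₀| * Real.sqrt 3) * (∑ i, ((x i : ℤ) : ℝ) ^ 2) ^ (-(1 / 2 : ℝ)) := by ring

/-- The Simon–Lieb lower bound in the variable `s`: `c₁ s^{-1} ≤ G` off the origin for some `c₁ > 0`
(`c₀‖x‖⁻² ≤ G` and `‖x‖² ≤ s`). [folklore] -/
theorem rpow_neg_one_le_criticalTwoPoint : ∃ c₁ : ℝ, 0 < c₁ ∧ ∀ x : Site 3, x ≠ 0 →
    c₁ * (∑ i, ((x i : ℤ) : ℝ) ^ 2) ^ (-(1 : ℝ)) ≤ criticalTwoPoint 3 x := by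
  obtain ⟨c₀, C₀, hc₀, hb⟩ := criticalTwoPoint_bounds_holds (d := 3) le_rfl
  refine ⟨c₀, hc₀, fun x hx => ?_⟩
  have h := (hb x hx).1
  have hn : 0 < ‖x‖ := PerfectScreening.norm_pos_of_ne_zero hx
  have hn2 : 0 < ‖x‖ ^ 2 := by positivity
  have hlow : ‖x‖ ^ 2 ≤ ∑ i, ((x i : ℤ) : ℝ) ^ 2 :=
    (Real.le_sqrt (norm_nonneg _) (by positivity)).1 (PerfectScreening.norm_le_sqrt_sum_sq x)
  rw [show -(((3 : ℕ) : ℝ) - 1) = (2 : ℝ) * (-1 : ℝ) by norm_num, Real.rpow_mul hn.le,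
    Real.rpow_two] at h
  calc c₀ * (∑ i, ((x i : ℤ) : ℝ) ^ 2) ^ (-(1 : ℝ)) ≤ c₀ * (‖x‖ ^ 2) ^ (-(1 : ℝ)) :=
        mul_le_mul_of_nonneg_left (Real.rpow_le_rpow_of_nonpos hn2 hlow (by norm_num)) hc₀.le
    _ ≤ criticalTwoPoint 3 x := h

/-- The telemetry in terms of `latticeLaplacianZd`: the crux's inlined left-hand side equals
`s(x) · (ΔG(x) / G(x))`. [folklore] -/
theorem telemetry_eq (x : Site 3) :
    (∑ i, ((x i : ℤ) : ℝ) ^ 2) * (((∑ i : Fin 3, (criticalTwoPoint 3 (x + Pi.single i 1) +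
      criticalTwoPoint 3 (x - Pi.single i 1))) - 6 * criticalTwoPoint 3 x) / criticalTwoPoint 3 x) =
    (∑ i, ((x i : ℤ) : ℝ) ^ 2) * (latticeLaplacianZd (criticalTwoPoint 3) x / criticalTwoPoint 3 x) := by
  rw [latticeLaplacianZd_three]

/-! ### No strongly repulsive inverse-square coupling under the Simon–Lieb lower bound -/

/-- **No repulsive inverse-square coupling beyond `2` under the lower bound `G ≥ c s^{-1}`.** There
is no `G : ℤ³ → ℝ` with `c₁ s^{-1} ≤ G ≤ C₁ s^{-1/2}` off the origin (`c₁ > 0`) that is a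
subsolution `(k/s) G ≤ ΔG` on an exterior region `{S ≤ s}` with `k > 2`: the power `s^{-p}`,
`2p(2p-1) = (k+2)/2`, has `p > 1` and is a supersolution of `Δ - k/s` far out, so the maximum
principle for the nonnegative potential `k/s` (`sub_le_super_of_hTransform`, `h = 1`, decay from
`G ≤ C₁ s^{-1/2} → 0`) gives `G ≤ M s^{-p}` far out, incompatible with `G ≥ c₁ s^{-1}`. [folklore] -/
theorem no_strong_repulsion {k c₁ C₁ S : ℝ} (hk : 2 < k) (hc₁ : 0 < c₁) {G : Site 3 → ℝ}
    (hGlow : ∀ x : Site 3, x ≠ 0 → c₁ * (∑ i, ((x i : ℤ) : ℝ) ^ 2) ^ (-(1 : ℝ)) ≤ G x)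
    (hGup : ∀ x : Site 3, x ≠ 0 → G x ≤ C₁ * (∑ i, ((x i : ℤ) : ℝ) ^ 2) ^ (-(1 / 2 : ℝ)))
    (hsub : ∀ x : Site 3, S ≤ ∑ i, ((x i : ℤ) : ℝ) ^ 2 →
      (k / ∑ i, ((x i : ℤ) : ℝ) ^ 2) * G x ≤ latticeLaplacianZd G x) : False := by
  obtain ⟨s, hs⟩ : ∃ s : Site 3 → ℝ, ∀ x, s x = ∑ i, ((x i : ℤ) : ℝ) ^ 2 := ⟨_, fun _ => rfl⟩
  simp only [← hs] at hGlow hGup hsub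
  have hs0 : s 0 = 0 := by rw [hs]; simp
  have hstend : Tendsto s cofinite atTop := by simpa only [← hs] using tendsto_sumSq_cofinite
  -- the exponent of the supersolution: `2p(2p-1) = κ'' = (k+2)/2 ∈ (2, k)`, `p > 1`
  set κ'' : ℝ := (k + 2) / 2 with hκ''
  have hκ''2 : 2 < κ'' := by rw [hκ'']; linarith
  have hκ''k : κ'' < k := by rw [hκ'']; linarith
  set r : ℝ := Real.sqrt (1 + 4 * κ'') with hr
  have hr3 : 3 < r := by
    have h9 : Real.sqrt 9 = 3 := by
      rw [show (9 : ℝ) = 3 ^ 2 by norm_num, Real.sqrt_sq (by norm_num : (0 : ℝ) ≤ 3)]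
    rw [hr, ← h9]
    exact Real.sqrt_lt_sqrt (by norm_num) (by linarith)
  have hrr : r ^ 2 = 1 + 4 * κ'' := Real.sq_sqrt (by linarith)
  set p : ℝ := (1 + r) / 4 with hp
  have hp1 : 1 < p := by rw [hp]; linarith
  have hp0 : 0 < p := by linarith
  have hκp : 2 * p * (2 * p - 1) = κ'' := by rw [hp]; linear_combination (1 / 4 : ℝ) * hrr
  obtain ⟨Kp, hKp0, hLp⟩ := latticeLaplacianZd_rpow_neg hp0
  simp only [← hs] at hLp
  simp only [hκp] at hLp
  -- thresholds
  have hgap : 0 < k - κ'' := by linarith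
  have hev : ∀ᶠ t : ℝ in atTop, 16 ≤ t ∧ (S ≤ t ∧ Kp * t ^ (-(1 / 2 : ℝ)) ≤ k - κ'') :=
    (eventually_ge_atTop 16).and ((eventually_ge_atTop S).and
      (eventually_mul_rpow_neg_le (by norm_num) _ hgap))
  obtain ⟨S₁, hS₁⟩ := Filter.eventually_atTop.1 hev
  set S₀ : ℝ := 4 * max S₁ 16 with hS₀def
  have hS₀64 : 64 ≤ S₀ := by
    have : (16 : ℝ) ≤ max S₁ 16 := le_max_right _ _
    rw [hS₀def]; linarith
  have hS₁S₀ : S₁ ≤ S₀ / 4 := by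
    have : S₁ ≤ max S₁ 16 := le_max_left _ _
    rw [hS₀def]; linarith
  clear_value S₀
  clear hev hS₀def
  have adm : ∀ x : Site 3, S₀ / 4 ≤ s x → x ≠ 0 ∧ 0 < s x ∧ 1 ≤ s x ∧ 16 ≤ s x ∧ S ≤ s x ∧
      Kp * s x ^ (-(1 / 2 : ℝ)) ≤ k - κ'' := by
    intro x hx
    obtain ⟨h16, hS, h1⟩ := hS₁ (s x) (hS₁S₀.trans hx)
    have hx0 : x ≠ 0 := by
      rintro rfl
      rw [hs0] at h16
      linarith
    exact ⟨hx0, by linarith, by linarith, h16, hS, h1⟩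
  obtain ⟨E, hE⟩ : ∃ E : Set (Site 3), E = {y : Site 3 | S₀ ≤ ∑ i, ((y i : ℤ) : ℝ) ^ 2} :=
    ⟨_, rfl⟩
  have hEmem : ∀ x, x ∈ E ↔ S₀ ≤ s x := fun x => by rw [hE, hs]; rfl
  have hEadm : ∀ x ∈ E ∪ zdOuterBoundary E, S₀ / 4 ≤ s x ∧ s x ≤ S₀ ∨ S₀ ≤ s x := by
    intro x hx
    rcases hx with hx | hx
    · exact Or.inr ((hEmem x).1 hx)
    · rw [hE] at hx
      obtain ⟨h1, h2⟩ := sumSq_of_mem_zdOuterBoundary hS₀64 hx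
      rw [← hs] at h1 h2
      exact Or.inl ⟨h1, h2.le⟩
  clear hE
  have hEadm' : ∀ x ∈ E ∪ zdOuterBoundary E, S₀ / 4 ≤ s x := by
    intro x hx
    rcases hEadm x hx with ⟨h, -⟩ | h
    · exact h
    · linarith
  -- the model potential `V = k/s ≥ 0`
  obtain ⟨V, hV⟩ : ∃ V : Site 3 → ℝ, ∀ x, V x = k / s x := ⟨_, fun _ => rfl⟩
  -- (1) the weight `h = 1` is a positive supersolution (`V ≥ 0`)
  have hpos : ∀ x ∈ E ∪ zdOuterBoundary E, 0 < (fun _ : Site 3 => (1 : ℝ)) x := fun _ _ => one_pos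
  have hsuper : ∀ x ∈ E, latticeLaplacianZd (fun _ : Site 3 => (1 : ℝ)) x ≤
      V x * (fun _ : Site 3 => (1 : ℝ)) x := by
    intro x hx
    obtain ⟨-, hsx0, -⟩ := adm x (hEadm' x (Or.inl hx))
    rw [latticeLaplacianZd_const, hV, mul_one]
    exact div_nonneg (by linarith) hsx0.le
  -- (2) `w = s^{-p}` is a supersolution of `Δ - V` on `E`
  have hwsuper : ∀ x ∈ E, latticeLaplacianZd (fun y => s y ^ (-p)) x ≤ V x * s x ^ (-p) := by
    intro x hx
    obtain ⟨-, hsx0, hs1, hs16, -, c1⟩ := adm x (hEadm' x (Or.inl hx))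
    have hL := hLp x hs16
    have hpow : ∀ a b : ℝ, s x ^ a * s x ^ b = s x ^ (a + b) := fun a b =>
      (Real.rpow_add hsx0 a b).symm
    set Q : ℝ := s x ^ (-p - 1) with hQ
    set v : ℝ := s x ^ (-(1 / 2 : ℝ)) with hv
    have hQ0 : 0 < Q := Real.rpow_pos_of_pos hsx0 _
    have e2 : s x ^ (-p - 3 / 2) = v * Q := by rw [hv, hQ, hpow]; congr 1; ring
    have e4 : s x ^ (-p) = s x * Q := by
      calc s x ^ (-p) = s x ^ ((1 : ℝ) + (-p - 1)) := by congr 1; ring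
        _ = s x ^ (1 : ℝ) * s x ^ (-p - 1) := Real.rpow_add hsx0 _ _
        _ = s x * Q := by rw [Real.rpow_one]
    rw [e2] at hL
    rw [e4, hV]
    have e5 : k / s x * (s x * Q) = k * Q := by field_simp
    rw [e5]
    obtain ⟨-, hL2⟩ := abs_le.1 hL
    have f1 : Q * (Kp * v) ≤ Q * (k - κ'') := mul_le_mul_of_nonneg_left c1 hQ0.le
    nlinarith [f1, hL2, hQ0]
  -- (3) `G` is a subsolution of `Δ - V` on `E`
  have hGsub : ∀ x ∈ E, V x * G x ≤ latticeLaplacianZd G x := by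
    intro x hx
    obtain ⟨-, -, -, -, hS, -⟩ := adm x (hEadm' x (Or.inl hx))
    rw [hV]
    exact hsub x hS
  -- (4) comparison: `G ≤ M s^{-p}` on `E`
  have hF : {y : Site 3 | s y ≤ S₀}.Finite := by simpa only [← hs] using finite_sumSq_le S₀
  have hbdryF : ∀ y ∈ zdOuterBoundary E, y ∈ {y : Site 3 | s y ≤ S₀} ∧ S₀ / 4 ≤ s y := by
    intro y hy
    rcases hEadm y (Or.inr hy) with ⟨h1, h2⟩ | h
    · exact ⟨h2, h1⟩
    · exact absurd ((hEmem y).2 h) hy.1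
  obtain ⟨M, hM0, hM⟩ := exists_le_mul_on_finite hF G (fun y => s y ^ (-p))
  have hupper : ∀ x ∈ E, G x ≤ M * s x ^ (-p) := by
    refine sub_le_super_of_hTransform (d := 3) (by norm_num) (E := E) (V := V) (u := G)
      (w := fun y => M * s y ^ (-p)) (h := fun _ : Site 3 => (1 : ℝ)) hpos hsuper hGsub ?_ ?_ ?_
    · intro x hx
      rw [latticeLaplacianZd_const_mul]
      have h := hwsuper x hx
      calc M * latticeLaplacianZd (fun y => s y ^ (-p)) x ≤ M * (V x * s x ^ (-p)) :=
            mul_le_mul_of_nonneg_left h hM0.le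
        _ = V x * (M * s x ^ (-p)) := by ring
    · intro y hy
      obtain ⟨hyF, hy4⟩ := hbdryF y hy
      obtain ⟨-, hsy0, -⟩ := adm y hy4
      exact hM y hyF (Real.rpow_pos_of_pos hsy0 _)
    · intro ε hε
      have hev' : ∀ᶠ x in cofinite, |C₁| * s x ^ (-(1 / 2 : ℝ)) ≤ ε :=
        hstend.eventually (eventually_mul_rpow_neg_le (by norm_num) |C₁| hε)
      filter_upwards [hev'] with x hx hxE
      have hx4 : S₀ / 4 ≤ s x := hEadm' x (Or.inl hxE)
      obtain ⟨hx0, hsx0, -⟩ := adm x hx4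
      have hw0 : 0 ≤ M * s x ^ (-p) := mul_nonneg hM0.le (Real.rpow_nonneg hsx0.le _)
      calc G x - M * s x ^ (-p) ≤ G x := by linarith
        _ ≤ C₁ * s x ^ (-(1 / 2 : ℝ)) := hGup x hx0
        _ ≤ |C₁| * s x ^ (-(1 / 2 : ℝ)) :=
            mul_le_mul_of_nonneg_right (le_abs_self _) (Real.rpow_nonneg hsx0.le _)
        _ ≤ ε := hx
        _ = ε * (fun _ : Site 3 => (1 : ℝ)) x := by simp
  -- (5) contradiction with the lower bound far out
  have hfar : ∀ᶠ t : ℝ in atTop, S₀ ≤ t ∧ M * t ^ (-(p - 1)) ≤ c₁ / 2 :=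
    (eventually_ge_atTop S₀).and (eventually_mul_rpow_neg_le (by linarith) _ (half_pos hc₁))
  obtain ⟨S₂, hS₂⟩ := Filter.eventually_atTop.1 hfar
  obtain ⟨x, -, hsx⟩ := exists_site_sumSq_ge S₂
  rw [← hs] at hsx
  obtain ⟨hS₀x, hMx⟩ := hS₂ (s x) hsx
  have hxE : x ∈ E := (hEmem x).2 hS₀x
  obtain ⟨hx0, hsx0, -⟩ := adm x (by linarith : S₀ / 4 ≤ s x)
  have h1 := hupper x hxE
  have h2 := hGlow x hx0
  have hsplit : s x ^ (-p) = s x ^ (-(p - 1)) * s x ^ (-(1 : ℝ)) := by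
    rw [← Real.rpow_add hsx0]; congr 1; ring
  have hsq0 : 0 < s x ^ (-(1 : ℝ)) := Real.rpow_pos_of_pos hsx0 _
  have h3 : G x ≤ c₁ / 2 * s x ^ (-(1 : ℝ)) := by
    calc G x ≤ M * s x ^ (-p) := h1
      _ = M * s x ^ (-(p - 1)) * s x ^ (-(1 : ℝ)) := by rw [hsplit, mul_assoc]
      _ ≤ c₁ / 2 * s x ^ (-(1 : ℝ)) := mul_le_mul_of_nonneg_right hMx hsq0.le
  nlinarith [h2, h3, hsq0, hc₁]

end TelemetricWindow

open TelemetricWindow InverseSquareLawUnitarity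

/-- **The telemetric constant is nonnegative (rate-free form of stub S2).** If the telemetry
`T(x) = |x|₂² · (Δ_{ℤ³}G)(x)/G(x)` of `G = criticalTwoPoint 3` tends to `κ` along the cofinite
filter of `ℤ³`, then `0 ≤ κ`: otherwise `ΔG ≤ -(k/s) G` far out (`k = min(-κ/2, 1/8)`), excluded by
`InverseSquareLawUnitarity.no_negative_coupling` and the infrared bound. [folklore] -/
theorem telemetricLimit_nonneg {κ : ℝ}
    (hlim : Filter.Tendsto (fun x : Literature.Probability.LatticeModels.Site 3 => (∑ i, ((x i : ℝ)) ^ 2) * (((∑ i : Fin 3, (Literature.Probability.LatticeModels.criticalTwoPoint 3 (x + Pi.single i 1) + Literature.Probability.LatticeModels.criticalTwoPoint 3 (x - Pi.single i 1))) - 6 * Literature.Probability.LatticeModels.criticalTwoPoint 3 x) / Literature.Probability.LatticeModels.criticalTwoPoint 3 x)) Filter.cofinite (nhds κ)) :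
    0 ≤ κ := by
  by_contra hκ
  push Not at hκ
  obtain ⟨C₁, hGup⟩ := criticalTwoPoint_le_rpow_neg_half
  set k : ℝ := min (-κ / 2) (1 / 8) with hk
  have hk0 : 0 < k := by
    rw [hk]
    exact lt_min (by linarith) (by norm_num)
  have hk8 : k ≤ 1 / 8 := min_le_right _ _
  have hkκ : κ ≤ -2 * k := by
    have : k ≤ -κ / 2 := min_le_left _ _
    linarith
  have hT : ∀ᶠ x : Site 3 in cofinite, dist ((∑ i, ((x i : ℤ) : ℝ) ^ 2) *
      (((∑ i : Fin 3, (criticalTwoPoint 3 (x + Pi.single i 1) + criticalTwoPoint 3 (x - Pi.single i 1))) -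
        6 * criticalTwoPoint 3 x) / criticalTwoPoint 3 x)) κ < k :=
    Metric.tendsto_nhds.1 hlim k hk0
  have hne : ∀ᶠ x : Site 3 in cofinite, x ≠ 0 := by
    refine Filter.eventually_cofinite.2 ((Set.finite_singleton (0 : Site 3)).subset ?_)
    intro x hx
    simp only [Set.mem_setOf_eq, not_not] at hx
    exact hx
  have hgood : ∀ᶠ x : Site 3 in cofinite, latticeLaplacianZd (criticalTwoPoint 3) x ≤
      -(k / ∑ i, ((x i : ℤ) : ℝ) ^ 2) * criticalTwoPoint 3 x := by
    filter_upwards [hT, hne] with x hTx hx0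
    rw [Real.dist_eq, telemetry_eq] at hTx
    have hS1 : (1 : ℝ) ≤ ∑ i, ((x i : ℤ) : ℝ) ^ 2 := PerfectScreening.one_le_sum_sq hx0
    have hS0 : (0 : ℝ) < ∑ i, ((x i : ℤ) : ℝ) ^ 2 := by linarith
    have hG0 := criticalTwoPoint_pos' x hx0
    set L : ℝ := latticeLaplacianZd (criticalTwoPoint 3) x with hL
    set σ : ℝ := ∑ i, ((x i : ℤ) : ℝ) ^ 2 with hσ
    obtain ⟨-, hT2⟩ := abs_lt.1 hTx
    have h1 : σ * (L / criticalTwoPoint 3 x) ≤ -k := by linarith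
    have h2 : L / criticalTwoPoint 3 x ≤ -k / σ := by
      rw [le_div_iff₀ hS0]; linarith
    have h3 : L ≤ -k / σ * criticalTwoPoint 3 x := by
      rwa [div_le_iff₀ hG0] at h2
    calc L ≤ -k / σ * criticalTwoPoint 3 x := h3
      _ = -(k / σ) * criticalTwoPoint 3 x := by rw [neg_div]
  obtain ⟨S, hS⟩ := exists_sumSq_threshold hgood
  exact no_negative_coupling hk0 hk8 criticalTwoPoint_pos' hGup hS

/-- **The telemetric constant is at most `2`.** If the telemetry of `G = criticalTwoPoint 3` tends to
`κ` along the cofinite filter of `ℤ³`, then `κ ≤ 2`: otherwise `ΔG ≥ (k/s) G` far out with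
`2 < k = (κ+2)/2`, excluded by `TelemetricWindow.no_strong_repulsion` and the Simon–Lieb lower bound
`G ≥ c‖x‖⁻²` of `criticalTwoPoint_bounds_holds`. [folklore] -/
theorem telemetricLimit_le_two {κ : ℝ}
    (hlim : Filter.Tendsto (fun x : Literature.Probability.LatticeModels.Site 3 => (∑ i, ((x i : ℝ)) ^ 2) * (((∑ i : Fin 3, (Literature.Probability.LatticeModels.criticalTwoPoint 3 (x + Pi.single i 1) + Literature.Probability.LatticeModels.criticalTwoPoint 3 (x - Pi.single i 1))) - 6 * Literature.Probability.LatticeModels.criticalTwoPoint 3 x) / Literature.Probability.LatticeModels.criticalTwoPoint 3 x)) Filter.cofinite (nhds κ)) :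
    κ ≤ 2 := by
  by_contra hκ
  push Not at hκ
  obtain ⟨C₁, hGup⟩ := criticalTwoPoint_le_rpow_neg_half
  obtain ⟨c₁, hc₁, hGlow⟩ := rpow_neg_one_le_criticalTwoPoint
  set k : ℝ := (κ + 2) / 2 with hk
  have hk2 : 2 < k := by rw [hk]; linarith
  have hkκ : 0 < κ - k := by rw [hk]; linarith
  have hT : ∀ᶠ x : Site 3 in cofinite, dist ((∑ i, ((x i : ℤ) : ℝ) ^ 2) *
      (((∑ i : Fin 3, (criticalTwoPoint 3 (x + Pi.single i 1) + criticalTwoPoint 3 (x - Pi.single i 1))) -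
        6 * criticalTwoPoint 3 x) / criticalTwoPoint 3 x)) κ < κ - k :=
    Metric.tendsto_nhds.1 hlim (κ - k) hkκ
  have hne : ∀ᶠ x : Site 3 in cofinite, x ≠ 0 := by
    refine Filter.eventually_cofinite.2 ((Set.finite_singleton (0 : Site 3)).subset ?_)
    intro x hx
    simp only [Set.mem_setOf_eq, not_not] at hx
    exact hx
  have hgood : ∀ᶠ x : Site 3 in cofinite, (k / ∑ i, ((x i : ℤ) : ℝ) ^ 2) * criticalTwoPoint 3 x ≤
      latticeLaplacianZd (criticalTwoPoint 3) x := by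
    filter_upwards [hT, hne] with x hTx hx0
    rw [Real.dist_eq, telemetry_eq] at hTx
    have hS1 : (1 : ℝ) ≤ ∑ i, ((x i : ℤ) : ℝ) ^ 2 := PerfectScreening.one_le_sum_sq hx0
    have hS0 : (0 : ℝ) < ∑ i, ((x i : ℤ) : ℝ) ^ 2 := by linarith
    have hG0 := criticalTwoPoint_pos' x hx0
    set L : ℝ := latticeLaplacianZd (criticalTwoPoint 3) x with hL
    set σ : ℝ := ∑ i, ((x i : ℤ) : ℝ) ^ 2 with hσ
    obtain ⟨hT1, -⟩ := abs_lt.1 hTx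
    have h1 : k ≤ σ * (L / criticalTwoPoint 3 x) := by linarith
    have h2 : k / σ ≤ L / criticalTwoPoint 3 x := by
      rw [div_le_iff₀ hS0]; linarith
    rwa [le_div_iff₀ hG0] at h2
  obtain ⟨S, hS⟩ := exists_sumSq_threshold hgood
  exact no_strong_repulsion hk2 hc₁ hGlow hGup hS

/-- **The rate-free window for the telemetric constant.** If the telemetry
`|x|₂² · (Δ_{ℤ³}G)/G` of the critical two-point function of the `ℤ³` Ising model has a limit `κ`
along the cofinite filter (the open stub S1 `stub_telemetricLimit` of crux `InverseSquareLaw`), then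
`0 ≤ κ ≤ 2` — the window `1 ≤ α₊(κ) ≤ 2` of decay exponents allowed by `c‖x‖⁻² ≤ G ≤ C‖x‖⁻¹`, obtained
here WITHOUT any rate hypothesis (`telemetricLimit_nonneg`, `telemetricLimit_le_two`). [folklore] -/
theorem telemetricLimit_mem_Icc {κ : ℝ}
    (hlim : Filter.Tendsto (fun x : Literature.Probability.LatticeModels.Site 3 => (∑ i, ((x i : ℝ)) ^ 2) * (((∑ i : Fin 3, (Literature.Probability.LatticeModels.criticalTwoPoint 3 (x + Pi.single i 1) + Literature.Probability.LatticeModels.criticalTwoPoint 3 (x - Pi.single i 1))) - 6 * Literature.Probability.LatticeModels.criticalTwoPoint 3 x) / Literature.Probability.LatticeModels.criticalTwoPoint 3 x)) Filter.cofinite (nhds κ)) :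
    κ ∈ Set.Icc (0 : ℝ) 2 :=
  ⟨telemetricLimit_nonneg hlim, telemetricLimit_le_two hlim⟩

end Summit.CriticalPhenomena.Ising3DConformalLimit.Theorems
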